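import Summits.QuantumFields.BalabanUV.Beta.SymAveragingMixedJetTables
import Summits.QuantumFields.BalabanUV.Beta.SymTablesAn1FirstOrder
import Summits.QuantumFields.BalabanUV.Beta.SecondOrderTableLawEnd

/-!
# `BalabanUV.Beta.SymSecondOrderTablesAn1` — binder row D1, TABLES-SYM step S2b (an1): THE SECOND-ORDER LETTERS (LB)(Lmix)(TB)(Tmix) OF THE
# (0.4)-SYMMETRISED TABLES IN THE RECORD's SHAPES, THE ROW BORDER TABLE `symVh₂SAn1`, AND THE HYPOTHESIS-FREE TABLE RECORD `symTablesAn1S2 d Lc cΛ`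

HONEST FRAMING (cell contract, verbatim): «discharging `BetaPertH` makes Bałaban's UV stability UNCONDITIONAL — a real constructive-QFT
result; it is NOT the continuum limit and NOT the Clay problem.»  THIS MODULE DISCHARGES NOTHING of `BetaPertH` ∕ row D1.  It closes the two
DISPLAYED second-order sockets of the owner's record `SymTablesAn1FirstOrder.symTablesAn1 d Lc cΛ vh₂S mixFF hB hmix hBt hmixt` (referee:
«second-order tables 0∕2») with an1's (0.4)-symmetrised WORDS of `SymAveragingMixedJetTables` and their kernel-checked letters: after this file
the (0.4) table record of row D1 is a CLOSED TERM `symTablesAn1S2 d Lc cΛ : SymTables d Lc` (only `[NeZero Lc]`), all nine structure letters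
(LV)(LH)(LM)(LB)(Lmix)(TV)(TH)(TM)(TB)(Tmix) being theorems of this package.  [folklore] throughout; 0 sorry, 0 `def … : Prop`, nothing cited
as a fact.  NOT D1, NOT BetaPertH, NOT continuum, NOT Clay.

WHAT:
* §1 the letters of the raw packed tables in the record's shapes, box root and centred root `ρ_c = ctr (d+1) L`: (Lmix) `symMixFFAt_hmix(_ctr)`
  (`∃ C δ, 0 < δ ∧ LocStencilFM L (symMixFFAt ρ L) C δ`, rate `1`), (Tmix) `symMixFFAt_hmixt`, (LB) `symVh₂SAt_hB(_ctr)` (`∃ C δ, 0 < δ ∧ LocStencil₂ …`),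
  (TB) `symVh₂SAt_hBt`;
* §2 **THE ROW BORDER TABLE** `symVh₂SAn1 d L κ u κ′ u′ := atw (½ • (symVh₂SAt ρ_c L κ u κ′ u′ + symVh₂SAt ρ_c L κ′ u′ κ u))` — the owner's
  prescription NOTE X-an2-46 (`SecondOrderSocketIdentification.vh₂SAn1`, the anti-twin packing `atw` of the jet-bond symmetrisation) applied to the
  (0.4) table, generic `d`; no field–field ∕ multiplier–multiplier block, anti-twin, swap-symmetric; **(LB)** `locStencil₂_symVh₂SAn1` (rate `1∕3`,
  constant `symVh2Abs ρ_c L · e^{6(d+1)L}`, by the owner's `biLoc_recentre` ∕ `biLoc_atw` — the proof of `SecondOrderTableLawEnd.locStencil₂_vh₂SAn1`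
  token for token) and **(TB)** `symVh₂SAn1_translate`;
* §3 **THE CLOSED RECORD** `symTablesAn1S2 d Lc cΛ := symTablesAn1 d Lc cΛ (symVh₂SAn1 d Lc) (symMixFFAt ρ_c Lc) hB hmix hBt hmixt` with the four
  letters supplied, `rfl` field lemmas, and the unfolding `symTablesAn1S2_def` by which every theorem stated for `symTablesAn1 d Lc cΛ vh₂S mixFF …`
  (e.g. the root `RowD1JointEndSymWardTablesAn1`) specialises verbatim.
NOT HERE (displayed further up the row, untouched): the second-order WARD laws (T2-B)(T2-M₂) of these tables, their reflection letters, any value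
of any table (an1's exact engine of record, OUTSIDE Lean), any claim that `symVh₂SAn1` is Bałaban's second-order jet beyond its definition.
HONEST DEPENDENCY (verbatim): «continuum YM on T⁴ ⇐ BetaPertH ∧ nine spine estimates (0/9 proved); BetaPertH ⇐ (D1) ∧ (D4) ∧ CAP+tail;
G-an2-4 gates asym, D1 and NE2/3/4.»  ABSOLUTE RULE (cell, verbatim): «No internally-minted statement may enter as a cited fact. Every
hypothesis is either kernel-proved in this package or a verbatim quotation of a PUBLISHED theorem with page reference.»
Provenance: β sub-cell, W-supplier `b2b-balaban-beta-an1` gen 43 (scratch for courier by the row-D1 owner), 2026-08-21; over an1's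
`SymAveragingMixedJetTables`, the owner's `SymTablesAn1FirstOrder` ∕ `SecondOrderSocketIdentification` ∕ `SecondOrderTableLawEnd` BY NAME; no
existing file touched.
-/

open Finset
open scoped BigOperators
open Literature.MathematicalPhysics.QuantumFieldTheory
open Literature.MathematicalPhysics.QuantumFieldTheory.Balaban1983to89
open Literature.MathematicalPhysics.QuantumFieldTheory.Balaban1983to89.Beta
open B12Sec2to5 (l1 l1_nonneg)
open ExpKernelCalculus (MKer BiLoc shiftK)
open AffineAveraging (box toSite)
open AveragingContoursRooted (ctr ctrOff ctrOff_mem_box)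
open OneStepResolventKernel (Fib LocStencil)
open KernelWard (biLoc_add)
open StepJetData (biLoc_weaken biLoc_smul)
open BalabanCompositeJets (LocStencil₂)
open SecondOrderResponse (LocStencilFM)
open BalabanStepW2 (wM1)
open Summit.QuantumFields.BalabanUV.Beta.AxialDressingRooted (one_le_of_neZero)
open Summit.QuantumFields.BalabanUV.Beta.SpineRooted (M1Of)
open Summit.QuantumFields.BalabanUV.Beta.SymmetrisedStepJets (SymTables)
open Summit.QuantumFields.BalabanUV.Beta.SymAveragingHessianCounts (symVhSAt symHessFFAt)
open Summit.QuantumFields.BalabanUV.Beta.SymTablesAn1FirstOrder (symTablesAn1)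
open Summit.QuantumFields.BalabanUV.Beta.SecondOrderSocketIdentification (atw)
open Summit.QuantumFields.BalabanUV.Beta.SecondOrderTableLawEnd (biLoc_atw atw_shiftK biLoc_recentre)
open Summit.QuantumFields.BalabanUV.Beta.SymAveragingMixedJetTables (symMixFFAt symVh₂SAt symMixFFAt_translate symVh₂SAt_translate
  biLoc_symMixFFAt biLoc_symVh₂SAt symMixAbs symVh2Abs symMixAbs_nonneg symVh2Abs_nonneg symVh₂SAt_symm)

namespace Summit.QuantumFields.BalabanUV.Beta.SymSecondOrderTablesAn1

noncomputable section

variable {d : ℕ}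

/-! ## §1 The letters of the raw packed tables in the record's shapes -/

section RawLetters

variable {L : ℕ} {r : Fin (d + 1) → ℕ}

/-- [folklore] **(Lmix) in the record's shape** (box root, rate `1`): `∃ C δ, 0 < δ ∧ LocStencilFM L (symMixFFAt ρ L) C δ`. -/
theorem symMixFFAt_hmix (hL : 1 ≤ L) (hr : r ∈ box (d + 1) L) : ∃ C δ : ℝ, 0 < δ ∧ LocStencilFM L (symMixFFAt (toSite r) L) C δ :=
  ⟨_, 1, one_pos, fun κ u μ y => biLoc_symMixFFAt hL hr zero_le_one κ u μ y⟩

/-- [folklore] **(Tmix) in the record's shape** (all roots). -/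
theorem symMixFFAt_hmixt (ρ : Fin (d + 1) → ℤ) (L : ℕ) :
    ∀ (κ : Fin (d + 1)) (u : Fin (d + 1) → ℤ) (μ : Fin (d + 1)) (w t : Fin (d + 1) → ℤ),
      symMixFFAt ρ L κ (u + (L : ℤ) • t) μ (w + t) = shiftK (-((L : ℤ) • t)) (symMixFFAt ρ L κ u μ w) :=
  fun κ u μ w t => symMixFFAt_translate ρ L κ u μ w t

/-- [folklore] **(LB) for the raw packed border table, record shape** (box root, rate `1`): `∃ C δ, 0 < δ ∧ LocStencil₂ (symVh₂SAt ρ L) C δ`. -/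
theorem symVh₂SAt_hB (hL : 1 ≤ L) (hr : r ∈ box (d + 1) L) : ∃ C δ : ℝ, 0 < δ ∧ LocStencil₂ (symVh₂SAt (toSite r) L) C δ :=
  ⟨_, 1, one_pos, fun κ u κ' u' => biLoc_symVh₂SAt hL hr zero_le_one κ u κ' u'⟩

/-- [folklore] **(TB) for the raw packed border table, record shape** (`1 ≤ L`, all roots). -/
theorem symVh₂SAt_hBt (hL : 1 ≤ L) (ρ : Fin (d + 1) → ℤ) :
    ∀ (κ : Fin (d + 1)) (u : Fin (d + 1) → ℤ) (κ' : Fin (d + 1)) (u' t : Fin (d + 1) → ℤ),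
      symVh₂SAt ρ L κ (u + (L : ℤ) • t) κ' (u' + (L : ℤ) • t) = shiftK (-((L : ℤ) • t)) (symVh₂SAt ρ L κ u κ' u') :=
  fun κ u κ' u' t => symVh₂SAt_translate hL ρ κ u κ' u' t

/-- [folklore] **(Lmix) at the centred root** `ρ_c = ctr (d+1) L` (only `1 ≤ L`). -/
theorem symMixFFAt_hmix_ctr (hL : 1 ≤ L) : ∃ C δ : ℝ, 0 < δ ∧ LocStencilFM L (symMixFFAt (ctr (d + 1) L) L) C δ :=
  symMixFFAt_hmix hL (ctrOff_mem_box hL)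

/-- [folklore] **(LB) for the raw packed border table at the centred root** (only `1 ≤ L`). -/
theorem symVh₂SAt_hB_ctr (hL : 1 ≤ L) : ∃ C δ : ℝ, 0 < δ ∧ LocStencil₂ (symVh₂SAt (ctr (d + 1) L) L) C δ :=
  symVh₂SAt_hB hL (ctrOff_mem_box hL)

end RawLetters

/-! ## §2 The row border table `symVh₂SAn1`: the anti-twin, jet-bond-symmetrised packing of the (0.4) border table (owner NOTE X-an2-46) -/

section Row

variable (d)

/-- [our object] **THE ROW BORDER TABLE OF THE (0.4) RECORD** (sym twin of `SecondOrderSocketIdentification.vh₂SAn1`, generic `d`, centred root):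
the anti-twin packing of the `(κ,u) ↔ (κ′,u′)` symmetrisation of an1's twin-packed symmetrised border table `symVh₂SAt ρ_c L`.  NOT asserted to be
Bałaban's second-order jet beyond this definition. -/
def symVh₂SAn1 (L : ℕ) : Fin (d + 1) → (Fin (d + 1) → ℤ) → Fin (d + 1) → (Fin (d + 1) → ℤ) → MKer (d + 1) (Fib d) :=
  fun κ u κ' u' => atw ((1 / 2 : ℝ) • (symVh₂SAt (ctr (d + 1) L) L κ u κ' u' + symVh₂SAt (ctr (d + 1) L) L κ' u' κ u))

variable {d}

/-- [folklore] The row table has no field–field block. -/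
@[simp] theorem symVh₂SAn1_inl_inl (L : ℕ) (κ : Fin (d + 1)) (u : Fin (d + 1) → ℤ) (κ' : Fin (d + 1)) (u' x z : Fin (d + 1) → ℤ)
    (β β' : Fin (d + 1)) : symVh₂SAn1 d L κ u κ' u' x z (Sum.inl β) (Sum.inl β') = 0 := rfl

/-- [folklore] The row table has no multiplier–multiplier block. -/
@[simp] theorem symVh₂SAn1_inr_inr (L : ℕ) (κ : Fin (d + 1)) (u : Fin (d + 1) → ℤ) (κ' : Fin (d + 1)) (u' x z : Fin (d + 1) → ℤ)
    (m m' : Fin (d + 1)) : symVh₂SAn1 d L κ u κ' u' x z (Sum.inr m) (Sum.inr m') = 0 := rfl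

/-- [folklore] The row table is anti-twin on the border. -/
theorem symVh₂SAn1_antiTwin (L : ℕ) (κ : Fin (d + 1)) (u : Fin (d + 1) → ℤ) (κ' : Fin (d + 1)) (u' x z : Fin (d + 1) → ℤ) (β m : Fin (d + 1)) :
    symVh₂SAn1 d L κ u κ' u' z x (Sum.inr m) (Sum.inl β) = -symVh₂SAn1 d L κ u κ' u' x z (Sum.inl β) (Sum.inr m) := rfl

/-- [folklore] The row table is symmetric in the two jet bonds. -/
theorem symVh₂SAn1_swap (L : ℕ) (κ : Fin (d + 1)) (u : Fin (d + 1) → ℤ) (κ' : Fin (d + 1)) (u' : Fin (d + 1) → ℤ) :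
    symVh₂SAn1 d L κ u κ' u' = symVh₂SAn1 d L κ' u' κ u := by
  funext x z a b
  rcases a with β | m <;> rcases b with β' | m' <;> simp [symVh₂SAn1, atw, add_comm]

/-- [folklore] **(LB) THE ROW TABLE IS A `LocStencil₂` FAMILY** (only `1 ≤ L`): rate `1∕3`, constant `symVh2Abs ρ_c L · e^{6(d+1)L}` — an1's
`biLoc_symVh₂SAt` (rate `1`) at both bond orders, the swapped one re-centred (`biLoc_recentre`), averaged, packed anti-twin (`biLoc_atw`). -/
theorem locStencil₂_symVh₂SAn1 {L : ℕ} (hL : 1 ≤ L) : ∃ C δ : ℝ, 0 < δ ∧ LocStencil₂ (symVh₂SAn1 d L) C δ := by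
  have hr := ctrOff_mem_box (d := d + 1) hL
  set A : ℝ := symVh2Abs (toSite (ctrOff (d + 1) L)) L * Real.exp (6 * ((d : ℝ) + 1) * L * 1) with hA
  have hA0 : 0 ≤ A := by rw [hA]; exact mul_nonneg (symVh2Abs_nonneg _ _) (Real.exp_pos _).le
  refine ⟨A, 1 / 3, by norm_num, fun κ u κ' u' => ?_⟩
  have h1 : BiLoc (symVh₂SAt (toSite (ctrOff (d + 1) L)) L κ u κ' u') u u (A * Real.exp (-(1 : ℝ) * l1 (u' - u))) 1 := by
    rw [hA]; exact biLoc_symVh₂SAt hL hr zero_le_one κ u κ' u'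
  have h2 : BiLoc (symVh₂SAt (toSite (ctrOff (d + 1) L)) L κ' u' κ u) u' u' (A * Real.exp (-(1 : ℝ) * l1 (u - u'))) 1 := by
    rw [hA]; exact biLoc_symVh₂SAt hL hr zero_le_one κ' u' κ u
  have h2' := biLoc_recentre hA0 zero_le_one h2
  have h1' : BiLoc (symVh₂SAt (toSite (ctrOff (d + 1) L)) L κ u κ' u') u u (A * Real.exp (-(1 / 3 : ℝ) * l1 (u' - u))) (1 / 3) := by
    refine biLoc_weaken h1 ?_ (by norm_num)
    refine mul_le_mul_of_nonneg_left ?_ hA0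
    rw [Real.exp_le_exp]
    nlinarith [l1_nonneg (u' - u)]
  have hsum := biLoc_smul (biLoc_add h1' h2') (1 / 2 : ℝ)
  have e : |(1 / 2 : ℝ)| * (A * Real.exp (-(1 / 3 : ℝ) * l1 (u' - u)) + A * Real.exp (-((1 : ℝ) / 3) * l1 (u' - u)))
      = A * Real.exp (-(1 / 3 : ℝ) * l1 (u' - u)) := by
    rw [abs_of_pos (by norm_num : (0 : ℝ) < 1 / 2)]; ring
  rw [e] at hsum
  exact biLoc_atw hsum (mul_nonneg hA0 (Real.exp_pos _).le)

/-- [folklore] **(TB) BLOCK-TRANSLATION COVARIANCE OF THE ROW TABLE** (only `1 ≤ L`), from `symVh₂SAt_translate` at both bond orders. -/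
theorem symVh₂SAn1_translate {L : ℕ} (hL : 1 ≤ L) (κ : Fin (d + 1)) (u : Fin (d + 1) → ℤ) (κ' : Fin (d + 1)) (u' t : Fin (d + 1) → ℤ) :
    symVh₂SAn1 d L κ (u + (L : ℤ) • t) κ' (u' + (L : ℤ) • t) = shiftK (-((L : ℤ) • t)) (symVh₂SAn1 d L κ u κ' u') := by
  unfold symVh₂SAn1
  rw [symVh₂SAt_translate hL, symVh₂SAt_translate hL, ← atw_shiftK]
  rfl

/-- [folklore] **(TB) in the record's letter shape** for the row table. -/
theorem symVh₂SAn1_hBt {L : ℕ} (hL : 1 ≤ L) :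
    ∀ (κ : Fin (d + 1)) (u : Fin (d + 1) → ℤ) (κ' : Fin (d + 1)) (u' t : Fin (d + 1) → ℤ),
      symVh₂SAn1 d L κ (u + (L : ℤ) • t) κ' (u' + (L : ℤ) • t) = shiftK (-((L : ℤ) • t)) (symVh₂SAn1 d L κ u κ' u') :=
  fun κ u κ' u' t => symVh₂SAn1_translate hL κ u κ' u' t

end Row

/-! ## §3 The closed (0.4) table record of row D1 -/

section Record

variable (d) (Lc : ℕ) [NeZero Lc]

/-- [our object] **THE (0.4) TABLE RECORD OF ROW D1 AS A CLOSED TERM** (centred root `ρ_c = ctr (d+1) Lc`): the owner's `symTablesAn1 d Lc cΛ` with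
its two displayed second-order sockets filled by an1's symmetrised words — `vh₂S := symVh₂SAn1 d Lc` (row border table), `mixFF := symMixFFAt ρ_c Lc`
(Q-C1 packing of the symmetrised mixed table) — and their four letters (LB) `locStencil₂_symVh₂SAn1`, (Lmix) `symMixFFAt_hmix_ctr`, (TB)
`symVh₂SAn1_hBt`, (Tmix) `symMixFFAt_hmixt`.  No hypothesis beyond `[NeZero Lc]`.  A CANDIDATE record; asserts nothing. -/
def symTablesAn1S2 (cΛ : ℝ) : SymTables d Lc :=
  symTablesAn1 d Lc cΛ (symVh₂SAn1 d Lc) (symMixFFAt (ctr (d + 1) Lc) Lc) (locStencil₂_symVh₂SAn1 (one_le_of_neZero Lc))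
    (symMixFFAt_hmix_ctr (one_le_of_neZero Lc)) (symVh₂SAn1_hBt (one_le_of_neZero Lc)) (symMixFFAt_hmixt (ctr (d + 1) Lc) Lc)

variable {d Lc} (cΛ : ℝ)

/-- [folklore] **UNFOLDING**: the closed record IS the owner's displayed record at an1's second-order words and letters (`rfl`) — every theorem about
`symTablesAn1 d Lc cΛ vh₂S mixFF hB hmix hBt hmixt` specialises to `symTablesAn1S2 d Lc cΛ` through this equation. -/
theorem symTablesAn1S2_def : symTablesAn1S2 d Lc cΛ =
    symTablesAn1 d Lc cΛ (symVh₂SAn1 d Lc) (symMixFFAt (ctr (d + 1) Lc) Lc) (locStencil₂_symVh₂SAn1 (one_le_of_neZero Lc))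
      (symMixFFAt_hmix_ctr (one_le_of_neZero Lc)) (symVh₂SAn1_hBt (one_le_of_neZero Lc)) (symMixFFAt_hmixt (ctr (d + 1) Lc) Lc) := rfl

/-- [folklore] The record's border table is an1's `symVhSAt ρ_c d Lc` (`rfl`). -/
@[simp] theorem symTablesAn1S2_V : (symTablesAn1S2 d Lc cΛ).V = symVhSAt (ctr (d + 1) Lc) d Lc := rfl

/-- [folklore] The record's constraint Hessian is an1's `symHessFFAt ρ_c Lc` (`rfl`). -/
@[simp] theorem symTablesAn1S2_H : (symTablesAn1S2 d Lc cΛ).H = symHessFFAt (ctr (d + 1) Lc) Lc := rfl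

/-- [folklore] The record's multiplier tables are `M1Of d Lc (symHessFFAt ρ_c Lc) cΛ` (`rfl`). -/
@[simp] theorem symTablesAn1S2_M : (symTablesAn1S2 d Lc cΛ).M = M1Of d Lc (symHessFFAt (ctr (d + 1) Lc) Lc) cΛ := rfl

/-- [folklore] The record's second-order border table is the row table `symVh₂SAn1 d Lc` (`rfl`). -/
@[simp] theorem symTablesAn1S2_vh₂S : (symTablesAn1S2 d Lc cΛ).vh₂S = symVh₂SAn1 d Lc := rfl

/-- [folklore] The record's mixed table is `symMixFFAt ρ_c Lc` (`rfl`). -/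
@[simp] theorem symTablesAn1S2_mixFF : (symTablesAn1S2 d Lc cΛ).mixFF = symMixFFAt (ctr (d + 1) Lc) Lc := rfl

/-- [folklore] The record's second-order border table has no field–field block. -/
theorem symTablesAn1S2_vh₂S_inl_inl (κ : Fin (d + 1)) (u : Fin (d + 1) → ℤ) (κ' : Fin (d + 1)) (u' x z : Fin (d + 1) → ℤ) (β β' : Fin (d + 1)) :
    (symTablesAn1S2 d Lc cΛ).vh₂S κ u κ' u' x z (Sum.inl β) (Sum.inl β') = 0 := rfl

/-- [folklore] The record's second-order border table is anti-twin on the border. -/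
theorem symTablesAn1S2_vh₂S_antiTwin (κ : Fin (d + 1)) (u : Fin (d + 1) → ℤ) (κ' : Fin (d + 1)) (u' x z : Fin (d + 1) → ℤ) (β m : Fin (d + 1)) :
    (symTablesAn1S2 d Lc cΛ).vh₂S κ u κ' u' z x (Sum.inr m) (Sum.inl β) = -(symTablesAn1S2 d Lc cΛ).vh₂S κ u κ' u' x z (Sum.inl β) (Sum.inr m) := rfl

/-- [folklore] The record's second-order border table is symmetric in the two jet bonds. -/
theorem symTablesAn1S2_vh₂S_swap (κ : Fin (d + 1)) (u : Fin (d + 1) → ℤ) (κ' : Fin (d + 1)) (u' : Fin (d + 1) → ℤ) :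
    (symTablesAn1S2 d Lc cΛ).vh₂S κ u κ' u' = (symTablesAn1S2 d Lc cΛ).vh₂S κ' u' κ u := symVh₂SAn1_swap Lc κ u κ' u'

/-- [folklore] The record's mixed table lives on the field–field block: it vanishes on `(inr, ·)`. -/
theorem symTablesAn1S2_mixFF_inr (κ : Fin (d + 1)) (u : Fin (d + 1) → ℤ) (μ : Fin (d + 1)) (y x x' : Fin (d + 1) → ℤ) (μ' : Fin (d + 1))
    (b : Fib d) : (symTablesAn1S2 d Lc cΛ).mixFF κ u μ y x x' (Sum.inr μ') b = 0 := by cases b <;> rfl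

/-- [folklore] … and on `(inl, inr)`. -/
theorem symTablesAn1S2_mixFF_inl_inr (κ : Fin (d + 1)) (u : Fin (d + 1) → ℤ) (μ : Fin (d + 1)) (y x x' : Fin (d + 1) → ℤ) (α μ' : Fin (d + 1)) :
    (symTablesAn1S2 d Lc cΛ).mixFF κ u μ y x x' (Sum.inl α) (Sum.inr μ') = 0 := rfl

end Record

end

end Summit.QuantumFields.BalabanUV.Beta.SymSecondOrderTablesAn1
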